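import Mathlib
import Summits.QuantumAdvantage.QuantumAdvantage.Theorems.MobiusLadderLiouvilleOrthogonalTC0Defs
import Summits.QuantumAdvantage.QuantumAdvantage.Theorems.MobiusLadderLiouvilleOrthogonalTC0StubFactor
import HarnessLib

/-!
# `LiouvilleOrthogonalTC0` (stmt-QuantumAdvantage-1393), line `Sketch` — stub `stub_cells`
# (a full cell is the product of its pieces)

Stub `stub_cells` of the line `Sketch` (card `multiplicative-xor-ladder`) of the crux
`Summit.QuantumAdvantage.QuantumAdvantage.Theses.MobiusLadder.LiouvilleOrthogonalTC0`.

For thresholds `z₀ ≤ z₁ ≤ … ≤ z_k` with `z_k ≥ 2ⁿ`, every `0 < N < 2ⁿ` factors as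
`N = s · u₀ ⋯ u_{k-1}` with `s = locPart 0 z₀ N` its `z₀`-smooth part and
`uᵢ = locPart zᵢ zᵢ₊₁ N` its `(zᵢ, zᵢ₊₁]`-local parts (`stub_factor` with thresholds `0 :: z`).
A CELL is the set of such `N` with prescribed `s` and prescribed boxes
`⌊log uᵢ / log(1+θ)⌋₊ = βᵢ`; it is FULL when `s · ∏ᵢ (1+θ)^(βᵢ+1) ≤ 2ⁿ`.  On a full cell the map
`N ↦ (uᵢ)ᵢ` is a bijection onto the product of the pieces `pieceSet n zᵢ zᵢ₊₁ ((1+θ)^βᵢ) θ`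
with inverse `t ↦ s · ∏ᵢ tᵢ` (fullness makes every such product `< 2ⁿ`); we state this as an
equality of sums for every test function `F` (`Finset.sum_nbij'`).  Ingredients: the three
conjuncts of `stub_factor (k+1) (Fin.cons 0 z)` (reconstruction, locality, uniqueness) and the
box characterisation `(1+θ)^β ≤ u < (1+θ)^(β+1) ↔ ⌊log u / log(1+θ)⌋₊ = β`.
-/

set_option linter.dupNamespace false -- D-0017: single-problem summit ⇒ `QuantumAdvantage.QuantumAdvantage` by design

noncomputable section

namespace Summit.QuantumAdvantage.QuantumAdvantage.Theorems.LiouvilleOrthogonalTC0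

open Filter Finset

namespace StubCells

/-- Box membership: for `θ > 0` and `u ≥ 1`, `(1+θ)^β(u) ≤ u < (1+θ)^(β(u)+1)` with
`β(u) = ⌊log u / log(1+θ)⌋₊`. -/
theorem box_mem {θ : ℝ} (hθ : 0 < θ) {u : ℝ} (hu : 1 ≤ u) :
    (1 + θ) ^ ⌊Real.log u / Real.log (1 + θ)⌋₊ ≤ u ∧
      u < (1 + θ) ^ (⌊Real.log u / Real.log (1 + θ)⌋₊ + 1) := by
  -- adapted from the lead's work/TransferDev.lean (`box_mem`)
  have h1 : 1 < 1 + θ := by linarith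
  have hlog : 0 < Real.log (1 + θ) := Real.log_pos h1
  have hu0 : 0 < u := by linarith
  have hq : 0 ≤ Real.log u / Real.log (1 + θ) := div_nonneg (Real.log_nonneg hu) hlog.le
  set β := ⌊Real.log u / Real.log (1 + θ)⌋₊ with hβ
  have hfl := Nat.floor_le hq
  have hlt := Nat.lt_floor_add_one (Real.log u / Real.log (1 + θ))
  constructor
  · have : (β : ℝ) * Real.log (1 + θ) ≤ Real.log u := by
      rw [← hβ] at hfl
      calc (β : ℝ) * Real.log (1 + θ) ≤ Real.log u / Real.log (1 + θ) * Real.log (1 + θ) :=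
            mul_le_mul_of_nonneg_right hfl hlog.le
        _ = Real.log u := div_mul_cancel₀ _ hlog.ne'
    have h2 : Real.log ((1 + θ) ^ β) ≤ Real.log u := by rwa [Real.log_pow]
    exact (Real.log_le_log_iff (pow_pos (by linarith) _) hu0).mp h2
  · have : Real.log u < ((β : ℝ) + 1) * Real.log (1 + θ) := by
      rw [← hβ] at hlt
      calc Real.log u = Real.log u / Real.log (1 + θ) * Real.log (1 + θ) :=
            (div_mul_cancel₀ _ hlog.ne').symm
        _ < ((β : ℝ) + 1) * Real.log (1 + θ) := mul_lt_mul_of_pos_right hlt hlog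
    have h2 : Real.log u < Real.log ((1 + θ) ^ (β + 1)) := by
      rw [Real.log_pow]; push_cast; exact this
    exact (Real.log_lt_log_iff hu0 (pow_pos (by linarith) _)).mp h2

/-- Conversely, a number in the box `[(1+θ)^β, (1+θ)^(β+1))` has box index `β`. -/
theorem box_idx_eq {θ : ℝ} (hθ : 0 < θ) {u : ℝ} {β : ℕ} (h1 : (1 + θ) ^ β ≤ u)
    (h2 : u < (1 + θ) ^ (β + 1)) : ⌊Real.log u / Real.log (1 + θ)⌋₊ = β := by
  -- adapted from the lead's work/TransferDev.lean (`box_idx_eq`)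
  have h1' : 1 < 1 + θ := by linarith
  have hlog : 0 < Real.log (1 + θ) := Real.log_pos h1'
  have hu0 : 0 < u := lt_of_lt_of_le (pow_pos (by linarith) _) h1
  rw [Nat.floor_eq_iff (div_nonneg (Real.log_nonneg ?_) hlog.le)]
  · constructor
    · rw [le_div_iff₀ hlog, ← Real.log_pow]
      exact Real.log_le_log (pow_pos (by linarith) _) h1
    · rw [div_lt_iff₀ hlog]
      have := Real.log_lt_log hu0 h2
      rw [Real.log_pow] at this
      push_cast at this
      exact this
  · exact le_trans (one_le_pow₀ h1'.le) h1

/-- Membership in a piece, unfolded. -/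
theorem mem_pieceSet {n y w u : ℕ} {b θ : ℝ} :
    u ∈ pieceSet n y w b θ ↔ u < 2 ^ n ∧ IsLocal y w u ∧ b ≤ (u : ℝ) ∧ (u : ℝ) < b * (1 + θ) := by
  simp only [pieceSet, Finset.mem_filter, Finset.mem_range]

/-- A local part is local: `locPart y w N ≠ 0` and all its prime factors lie in `(y, w]`. -/
theorem isLocal_locPart (y w N : ℕ) : IsLocal y w (locPart y w N) := by
  refine ⟨StubFactor.locProd_ne_zero N y w, fun p hp => ?_⟩
  have hp' : p ∈ N.primeFactors.filter (fun p => y < p ∧ p ≤ w) := by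
    rw [← StubFactor.primeFactors_locProd]
    exact hp
  exact (Finset.mem_filter.mp hp').2

/-- The threshold sequence `0 :: z` is monotone. -/
theorem monotone_cons {k : ℕ} {z : Fin (k + 1) → ℕ} (hz : Monotone z) :
    Monotone (Fin.cons 0 z : Fin (k + 1 + 1) → ℕ) :=
  Monotone.vecCons hz (Nat.zero_le _)

/-- Reconstruction: `0 < N < 2ⁿ ≤ z_k` is its `(0, z₀]`-part times its `(zᵢ, zᵢ₊₁]`-parts. -/
theorem recon {n k : ℕ} {z : Fin (k + 1) → ℕ} (hz : Monotone z) (htop : 2 ^ n ≤ z (Fin.last k))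
    {N : ℕ} (hN0 : N ≠ 0) (hN : N < 2 ^ n) :
    locPart 0 (z 0) N * ∏ i : Fin k, locPart (z i.castSucc) (z i.succ) N = N := by
  have hprime : ∀ p ∈ N.primeFactors, (Fin.cons 0 z : Fin (k + 1 + 1) → ℕ) 0 < p ∧
      p ≤ (Fin.cons 0 z : Fin (k + 1 + 1) → ℕ) (Fin.last (k + 1)) := by
    intro p hp
    refine ⟨?_, ?_⟩
    · rw [Fin.cons_zero]
      exact Nat.pos_of_mem_primeFactors hp
    · rw [← Fin.succ_last, Fin.cons_succ]
      exact (Nat.le_of_mem_primeFactors hp).trans (hN.le.trans htop)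
  have h := (stub_factor (k + 1) (Fin.cons 0 z) (monotone_cons hz)).1 N hN0 hprime
  rw [Fin.prod_univ_succ] at h
  simpa only [locPart, Fin.cons_zero, Fin.castSucc_zero, Fin.cons_succ, Fin.castSucc_succ] using h

/-- Uniqueness: the local parts of `s · ∏ tᵢ` (`s` `(0, z₀]`-local, `tᵢ` `(zᵢ, zᵢ₊₁]`-local) are
`s` and the `tᵢ`. -/
theorem uniq {k : ℕ} {z : Fin (k + 1) → ℕ} (hz : Monotone z) {s : ℕ} (hs : IsLocal 0 (z 0) s)
    {t : Fin k → ℕ} (ht : ∀ i, IsLocal (z i.castSucc) (z i.succ) (t i)) :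
    locPart 0 (z 0) (s * ∏ i, t i) = s ∧
      ∀ j : Fin k, locPart (z j.castSucc) (z j.succ) (s * ∏ i, t i) = t j := by
  have hu : ∀ i : Fin (k + 1), (Fin.cons s t : Fin (k + 1) → ℕ) i ≠ 0 ∧
      ∀ r ∈ ((Fin.cons s t : Fin (k + 1) → ℕ) i).primeFactors,
        (Fin.cons 0 z : Fin (k + 1 + 1) → ℕ) i.castSucc < r ∧
          r ≤ (Fin.cons 0 z : Fin (k + 1 + 1) → ℕ) i.succ := by
    intro i
    refine Fin.cases ?_ (fun j => ?_) i
    · simp only [Fin.cons_zero, Fin.castSucc_zero, Fin.cons_succ]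
      exact hs
    · simp only [Fin.cons_succ, Fin.castSucc_succ]
      exact ht j
  have h := (stub_factor (k + 1) (Fin.cons 0 z) (monotone_cons hz)).2.2 (Fin.cons s t) hu
  have hprod : (∏ i, (Fin.cons s t : Fin (k + 1) → ℕ) i) = s * ∏ i, t i := Fin.prod_cons s t
  refine ⟨?_, fun j => ?_⟩
  · simpa only [locPart, hprod, Fin.cons_zero, Fin.castSucc_zero, Fin.cons_succ] using h 0
  · simpa only [locPart, hprod, Fin.cons_succ, Fin.castSucc_succ] using h j.succ

end StubCells

/-- **Stub `stub_cells` (cell bijection).** In a FULL cell — smooth part `s` (a `(0, z₀]`-local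
number) and boxes `β`, with `s · ∏ᵢ (1+θ)^(βᵢ+1) ≤ 2ⁿ` — the map `N ↦ (locPart zᵢ zᵢ₊₁ N)ᵢ` is a
bijection from the `N ∈ [1, 2ⁿ)` of the cell onto the product of the pieces
`pieceSet n zᵢ zᵢ₊₁ ((1+θ)^βᵢ) θ`, with inverse `t ↦ s · ∏ᵢ tᵢ`; stated as an equality of sums for
every test function `F`. -/
theorem stub_cells (n k : ℕ) (hk : 1 ≤ k) (θ : ℝ) (hθ : 0 < θ) (z : Fin (k + 1) → ℕ)
    (hz : Monotone z) (htop : 2 ^ n ≤ z (Fin.last k)) (s : ℕ) (hs : IsLocal 0 (z 0) s)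
    (β : Fin k → ℕ) (hfull : (s : ℝ) * ∏ i, (1 + θ) ^ (β i + 1) ≤ (2 : ℝ) ^ n) (F : ℕ → ℝ) :
    ∑ N ∈ (range (2 ^ n)).filter (fun N => N ≠ 0 ∧ locPart 0 (z 0) N = s ∧
        ∀ i : Fin k, ⌊Real.log (locPart (z i.castSucc) (z i.succ) N) / Real.log (1 + θ)⌋₊ = β i),
      F N =
    ∑ t ∈ Fintype.piFinset
        (fun i : Fin k => pieceSet n (z i.castSucc) (z i.succ) ((1 + θ) ^ β i) θ),
      F (s * ∏ i, t i) := by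
  -- pieces are local, below `2ⁿ`, and in their boxes
  have hpiece : ∀ t : Fin k → ℕ,
      t ∈ Fintype.piFinset
        (fun i : Fin k => pieceSet n (z i.castSucc) (z i.succ) ((1 + θ) ^ β i) θ) →
      ∀ i, t i < 2 ^ n ∧ IsLocal (z i.castSucc) (z i.succ) (t i) ∧
        (1 + θ) ^ β i ≤ (t i : ℝ) ∧ (t i : ℝ) < (1 + θ) ^ β i * (1 + θ) := fun t ht i =>
    StubCells.mem_pieceSet.mp (Fintype.mem_piFinset.mp ht i)
  refine Finset.sum_nbij' (fun N i => locPart (z i.castSucc) (z i.succ) N) (fun t => s * ∏ i, t i)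
    ?_ ?_ ?_ ?_ ?_
  · -- the local parts of a cell element lie in the pieces
    intro N hN
    rw [Finset.mem_filter, Finset.mem_range] at hN
    obtain ⟨hNlt, hN0, -, hNβ⟩ := hN
    refine Fintype.mem_piFinset.mpr fun i => StubCells.mem_pieceSet.mpr ?_
    have hrec := StubCells.recon hz htop hN0 hNlt
    have hloc : IsLocal (z i.castSucc) (z i.succ) (locPart (z i.castSucc) (z i.succ) N) :=
      StubCells.isLocal_locPart _ _ _
    have hdvd : locPart (z i.castSucc) (z i.succ) N ∣ N := by
      have h1 : locPart (z i.castSucc) (z i.succ) N ∣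
          ∏ j : Fin k, locPart (z j.castSucc) (z j.succ) N :=
        Finset.dvd_prod_of_mem (fun j : Fin k => locPart (z j.castSucc) (z j.succ) N)
          (Finset.mem_univ i)
      have h2 := Dvd.dvd.mul_left h1 (locPart 0 (z 0) N)
      rwa [hrec] at h2
    have hult : locPart (z i.castSucc) (z i.succ) N < 2 ^ n :=
      lt_of_le_of_lt (Nat.le_of_dvd (Nat.pos_of_ne_zero hN0) hdvd) hNlt
    have hu1 : (1 : ℝ) ≤ (locPart (z i.castSucc) (z i.succ) N : ℝ) := by
      exact_mod_cast Nat.one_le_iff_ne_zero.mpr hloc.1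
    have hbox := StubCells.box_mem hθ hu1
    rw [hNβ i, pow_succ] at hbox
    exact ⟨hult, hloc, hbox⟩
  · -- the product of a tuple of piece elements lies in the cell
    intro t ht
    have ht' := hpiece t ht
    rw [Finset.mem_filter, Finset.mem_range]
    obtain ⟨h0, hj⟩ := StubCells.uniq hz hs (fun i => (ht' i).2.1)
    refine ⟨?_, ?_, h0, fun i => ?_⟩
    · have hlt : ((s * ∏ i, t i : ℕ) : ℝ) < (2 : ℝ) ^ n := by
        push_cast
        calc (s : ℝ) * ∏ i, (t i : ℝ) < s * ∏ i, (1 + θ) ^ (β i + 1) := by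
              refine mul_lt_mul_of_pos_left ?_ (by exact_mod_cast Nat.pos_of_ne_zero hs.1)
              refine Finset.prod_lt_prod_of_nonempty (fun i _ => ?_) (fun i _ => ?_) ?_
              · exact_mod_cast Nat.pos_of_ne_zero (ht' i).2.1.1
              · rw [pow_succ]; exact (ht' i).2.2.2
              · exact Finset.univ_nonempty_iff.mpr ⟨⟨0, hk⟩⟩
          _ ≤ 2 ^ n := hfull
      exact_mod_cast hlt
    · exact mul_ne_zero hs.1 (Finset.prod_ne_zero_iff.mpr fun i _ => (ht' i).2.1.1)
    · rw [hj i]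
      exact StubCells.box_idx_eq hθ (ht' i).2.2.1 (by rw [pow_succ]; exact (ht' i).2.2.2)
  · -- left inverse
    intro N hN
    rw [Finset.mem_filter, Finset.mem_range] at hN
    obtain ⟨hNlt, hN0, hNs, -⟩ := hN
    have := StubCells.recon hz htop hN0 hNlt
    rw [hNs] at this
    exact this
  · -- right inverse
    intro t ht
    funext j
    exact (StubCells.uniq hz hs (fun i => (hpiece t ht i).2.1)).2 j
  · -- the summands agree
    intro N hN
    rw [Finset.mem_filter, Finset.mem_range] at hN
    obtain ⟨hNlt, hN0, hNs, -⟩ := hN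
    have := StubCells.recon hz htop hN0 hNlt
    rw [hNs] at this
    exact congrArg F this.symm

end Summit.QuantumAdvantage.QuantumAdvantage.Theorems.LiouvilleOrthogonalTC0
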